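import Literature.Analysis.FluidPDE.GaussianVortexFlatNash
import Literature.Analysis.FluidPDE.SobolevWholeSpace
import Literature.Analysis.FluidPDE.RapidDecayLemmas
import HarnessLib

/-!
# The planar Nash inequality without compact support

Literature file (topic `Analysis/FluidPDE`), all results proved, no definitions, no named facts.
The tree's `sq_integral_sq_le_nash` (`GaussianVortexFlatNash`) is J. Nash's inequality on the
plane,

  `(∫ f²)² ≤ 4 C_GNS (∫ |f|)² ∫ ‖Df‖²`, `C_GNS = lintegralPowLePowLIntegralFDerivConst volume 2`,

for `f ∈ C¹_c(ℝ²)` (Nash 1958, the inequality `‖f‖₂^{1+2/n} ≤ C ‖f‖₁^{2/n} ‖∇f‖₂`, `n = 2`; in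
the tree it is derived from Mathlib's Gagliardo–Nirenberg–Sobolev inequality). Here the
compact-support hypothesis is removed, WITH THE SAME CONSTANT: the inequality holds for every `C¹`
function `f` with `f ∈ L¹ ∩ L²` and `Df ∈ L²` (`sq_integral_sq_le_nash_of_integrable`), in
particular for `C¹` functions decaying together with their derivative like `(1 + ‖x‖)^{-r}`,
`r > 2` (`sq_integral_sq_le_nash_of_decay`) — the form needed by the energy method for classical,
rapidly decaying solutions of the planar vorticity equation (Carlen–Loss 1995; Gallay–Wayne 2005,
Thm. 1.1), whose slices are never compactly supported.

Proof (truncation, as in Evans, *PDE*, §5.6.1, proof of Thm. 2, and as in the tree's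
`SobolevWholeSpace`): with the smooth cut-offs `χ_R = cutoff R` (`= 1` on `B_R`, `|χ_R| ≤ 1`,
`‖Dχ_R‖ ≤ C/R`), `f_n = χ_{n+1} f ∈ C¹_c` satisfies Nash's inequality; `∫ |f_n| ≤ ∫ |f|`,
`∫ f_n² → ∫ f²` and `∫ ‖Df_n‖² → ∫ ‖Df‖²` by dominated convergence (`f_n = f` near every fixed
point eventually, and `‖Df_n‖ ≤ ‖Df‖ + C|f|`), so the inequality passes to the limit.

## Mathlib / tree search

Mathlib (this pin) has the GNS inequality only for compactly supported or boundedly supported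
functions (`SobolevInequality.lean`) and no Nash inequality; the tree has Nash for `C¹_c(ℝ²)`
(`sq_integral_sq_le_nash`) and the whole-space GNS (`eLpNorm_le_eLpNorm_fderiv_of_eq_of_eLpNorm_lt_top`);
nothing for non-compactly-supported `f` in Nash's form (searched `Nash`, `nash`,
`GagliardoNirenberg`, `eLpNorm_le_eLpNorm_fderiv`).

## References

* [Nash1958] J. Nash, *Continuity of solutions of parabolic and elliptic equations*, Amer. J. Math.
  80 (1958) 931–954 — the inequality bearing his name (p. 936).
* [CarlenLoss1995] E. A. Carlen, M. Loss, *Optimal smoothing and decay estimates for viscously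
  damped conservation laws, with applications to the 2-D Navier–Stokes equation*, Duke Math. J. 81
  (1995) 135–157 — sharp Nash constant and its use for the planar vorticity equation.
* [Evans2010] L. C. Evans, *Partial Differential Equations*, 2nd ed., §5.6.1 Thm. 2 (truncation).
-/

noncomputable section

open MeasureTheory Set Function Filter
open _root_.Topology
open scoped ENNReal NNReal Topology

namespace Literature.Analysis.FluidPDE

/-- **The planar Nash inequality without compact support.** For every `C¹` function
`f : ℝ² → ℝ` with `f ∈ L¹`, `f ∈ L²` and `Df ∈ L²`,
`(∫ f²)² ≤ 4 C_GNS (∫ |f|)² ∫ ‖Df‖²` with `C_GNS = lintegralPowLePowLIntegralFDerivConst volume 2`,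
the same constant as the tree's compactly supported case `sq_integral_sq_le_nash` (Nash 1958,
`n = 2`; truncation `f_n = χ_{n+1} f` and dominated convergence remove the compact support).
[cite: Nash1958, p. 936 (the inequality for n = 2); Evans2010, §5.6.1 Thm. 2 (truncation)] -/
theorem sq_integral_sq_le_nash_of_integrable {f : EuclideanSpace ℝ (Fin 2) → ℝ}
    (hf : ContDiff ℝ 1 f) (h1 : Integrable f) (h2 : Integrable fun x => f x ^ 2)
    (hD : Integrable fun x => ‖fderiv ℝ f x‖ ^ 2) :
    (∫ x, f x ^ 2) ^ 2 ≤
      4 * (lintegralPowLePowLIntegralFDerivConst (volume : Measure (EuclideanSpace ℝ (Fin 2))) 2 : ℝ) *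
        (∫ x, |f x|) ^ 2 * ∫ x, ‖fderiv ℝ f x‖ ^ 2 := by
  obtain ⟨C, hC0, hC⟩ := exists_norm_fderiv_cutoff_le (E := EuclideanSpace ℝ (Fin 2))
  set K : ℝ :=
    4 * (lintegralPowLePowLIntegralFDerivConst (volume : Measure (EuclideanSpace ℝ (Fin 2))) 2 : ℝ)
    with hK
  have hK0 : 0 ≤ K := by positivity
  have hfc : Continuous f := hf.continuous
  have hDc : Continuous fun x => fderiv ℝ f x := hf.continuous_fderiv one_ne_zero
  -- the truncations `f_n = χ_{n+1} f`
  set fn : ℕ → EuclideanSpace ℝ (Fin 2) → ℝ := fun n x => cutoff ((n : ℝ) + 1) x * f x with hfn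
  have hRpos : ∀ n : ℕ, (0 : ℝ) < n + 1 := fun n => by positivity
  have hfn1 : ∀ n, ContDiff ℝ 1 (fn n) := fun n => (contDiff_cutoff _).mul hf
  have hfns : ∀ n, HasCompactSupport (fn n) := fun n =>
    (hasCompactSupport_cutoff (hRpos n)).mul_right
  -- Nash for each truncation, with `∫ |f_n| ≤ ∫ |f|`
  have hle1 : ∀ n, ∫ x, |fn n x| ≤ ∫ x, |f x| := by
    intro n
    refine integral_mono_of_nonneg (Eventually.of_forall fun x => abs_nonneg _) h1.abs
      (Eventually.of_forall fun x => ?_)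
    simp only [hfn, abs_mul]
    exact mul_le_of_le_one_left (abs_nonneg _) (abs_cutoff_le_one _ _)
  have hN : ∀ n, (∫ x, fn n x ^ 2) ^ 2 ≤ K * (∫ x, |f x|) ^ 2 * ∫ x, ‖fderiv ℝ (fn n) x‖ ^ 2 := by
    intro n
    have h := sq_integral_sq_le_nash (hfn1 n) (hfns n)
    rw [← hK] at h
    refine h.trans ?_
    have h0 : 0 ≤ ∫ x, |fn n x| := integral_nonneg fun x => abs_nonneg _
    have hD0 : 0 ≤ ∫ x, ‖fderiv ℝ (fn n) x‖ ^ 2 := integral_nonneg fun x => sq_nonneg _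
    exact mul_le_mul_of_nonneg_right
      (mul_le_mul_of_nonneg_left (pow_le_pow_left₀ h0 (hle1 n) 2) hK0) hD0
  -- `∫ f_n² → ∫ f²`
  have hlim2 : Tendsto (fun n => ∫ x, fn n x ^ 2) atTop (𝓝 (∫ x, f x ^ 2)) := by
    refine tendsto_integral_of_dominated_convergence (fun x => f x ^ 2)
      (fun n => ((hfn1 n).continuous.pow 2).aestronglyMeasurable) h2
      (fun n => Eventually.of_forall fun x => ?_) (Eventually.of_forall fun x => ?_)
    · rw [Real.norm_eq_abs, abs_pow, hfn]
      dsimp only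
      rw [abs_mul, mul_pow, ← sq_abs (f x)]
      exact mul_le_of_le_one_left (sq_nonneg _)
        (pow_le_one₀ (abs_nonneg _) (abs_cutoff_le_one _ _))
    · have h := ((tendsto_cutoff_natCast_add_one x).mul_const (f x)).pow 2
      simpa [hfn] using h
  -- `‖Df_n‖² ≤ 2‖Df‖² + 2C²f²`, and `Df_n(x) = Df(x)` eventually
  have hbd : ∀ n x, ‖fderiv ℝ (fn n) x‖ ^ 2 ≤ 2 * ‖fderiv ℝ f x‖ ^ 2 + 2 * (C ^ 2 * f x ^ 2) := by
    intro n x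
    have h := SobolevWholeSpace.norm_fderiv_cutoff_smul_le hf (hC _ (hRpos n)) x
    have h' : ‖fderiv ℝ (fn n) x‖ ≤ ‖fderiv ℝ f x‖ + C * |f x| := by
      have e : (fun y => cutoff ((n : ℝ) + 1) y • f y) = fn n := by
        funext y; simp [hfn, smul_eq_mul]
      rw [e, Real.norm_eq_abs] at h
      refine h.trans ?_
      gcongr
      exact div_le_self hC0 (by linarith [(Nat.cast_nonneg n : (0 : ℝ) ≤ n)])
    have ha : 0 ≤ ‖fderiv ℝ f x‖ := norm_nonneg _
    have hb : 0 ≤ C * |f x| := by positivity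
    calc ‖fderiv ℝ (fn n) x‖ ^ 2 ≤ (‖fderiv ℝ f x‖ + C * |f x|) ^ 2 :=
          pow_le_pow_left₀ (norm_nonneg _) h' 2
      _ ≤ 2 * ‖fderiv ℝ f x‖ ^ 2 + 2 * (C ^ 2 * f x ^ 2) := by
          rw [show C ^ 2 * f x ^ 2 = (C * |f x|) ^ 2 by rw [mul_pow, sq_abs]]
          nlinarith [sq_nonneg (‖fderiv ℝ f x‖ - C * |f x|)]
  have hev : ∀ x, ∀ᶠ n : ℕ in atTop, fderiv ℝ (fn n) x = fderiv ℝ f x := by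
    intro x
    have hT : Tendsto (fun n : ℕ => (n : ℝ) + 1) atTop atTop :=
      tendsto_natCast_atTop_atTop.atTop_add tendsto_const_nhds
    filter_upwards [hT.eventually (eventually_gt_atTop ‖x‖)] with n hn
    refine Filter.EventuallyEq.fderiv_eq ?_
    have hopen : IsOpen {y : EuclideanSpace ℝ (Fin 2) | ‖y‖ < (n : ℝ) + 1} :=
      isOpen_lt continuous_norm continuous_const
    filter_upwards [hopen.mem_nhds hn] with y hy
    simp only [hfn]
    rw [cutoff_eq_one (hRpos n) (le_of_lt hy), one_mul]
  have hlimD : Tendsto (fun n => ∫ x, ‖fderiv ℝ (fn n) x‖ ^ 2) atTop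
      (𝓝 (∫ x, ‖fderiv ℝ f x‖ ^ 2)) := by
    refine tendsto_integral_of_dominated_convergence
      (fun x => 2 * ‖fderiv ℝ f x‖ ^ 2 + 2 * (C ^ 2 * f x ^ 2))
      (fun n => (((hfn1 n).continuous_fderiv one_ne_zero).norm.pow 2).aestronglyMeasurable)
      ((hD.const_mul 2).add ((h2.const_mul (C ^ 2)).const_mul 2))
      (fun n => Eventually.of_forall fun x => ?_) (Eventually.of_forall fun x => ?_)
    · rw [Real.norm_of_nonneg (sq_nonneg _)]
      exact hbd n x
    · exact tendsto_const_nhds.congr' <| by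
        filter_upwards [hev x] with n hn
        rw [hn]
  -- pass to the limit
  exact le_of_tendsto_of_tendsto' (hlim2.pow 2) (hlimD.const_mul (K * (∫ x, |f x|) ^ 2)) hN

/-- A bound `|θ x| ≤ A (1 + ‖x‖)^{-r}` forces `0 ≤ A` (evaluate at `x = 0`). [folklore] -/
private theorem nonneg_of_abs_le_mul_rpow_neg {θ : EuclideanSpace ℝ (Fin 2) → ℝ} {A r : ℝ}
    (h : ∀ x, |θ x| ≤ A * (1 + ‖x‖) ^ (-r)) : 0 ≤ A := by
  have h0 := h 0
  rw [norm_zero, add_zero, Real.one_rpow, mul_one] at h0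
  exact (abs_nonneg _).trans h0

/-- **The planar Nash inequality for decaying functions.** For every `C¹` function `f : ℝ² → ℝ`
with `|f(x)| ≤ A (1 + ‖x‖)^{-r}` and `‖Df(x)‖ ≤ A (1 + ‖x‖)^{-r}` for some `r > 2`:
`(∫ f²)² ≤ 4 C_GNS (∫ |f|)² ∫ ‖Df‖²` (the integrability hypotheses of
`sq_integral_sq_le_nash_of_integrable` follow from the decay). This is the form used for the
slices of a classical, rapidly decaying solution of the planar vorticity equation
(Carlen–Loss 1995; Gallay–Wayne 2005, Thm. 1.1).
[cite: Nash1958, p. 936 (the inequality for n = 2); CarlenLoss1995, §1 (use for 2-D vorticity)] -/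
theorem sq_integral_sq_le_nash_of_decay {f : EuclideanSpace ℝ (Fin 2) → ℝ} (hf : ContDiff ℝ 1 f)
    {A r : ℝ} (hr : 2 < r) (h0 : ∀ x, |f x| ≤ A * (1 + ‖x‖) ^ (-r))
    (h1 : ∀ x, ‖fderiv ℝ f x‖ ≤ A * (1 + ‖x‖) ^ (-r)) :
    (∫ x, f x ^ 2) ^ 2 ≤
      4 * (lintegralPowLePowLIntegralFDerivConst (volume : Measure (EuclideanSpace ℝ (Fin 2))) 2 : ℝ) *
        (∫ x, |f x|) ^ 2 * ∫ x, ‖fderiv ℝ f x‖ ^ 2 := by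
  have hA : 0 ≤ A := nonneg_of_abs_le_mul_rpow_neg h0
  have hr2 : (Module.finrank ℝ (EuclideanSpace ℝ (Fin 2)) : ℝ) < r := by
    rw [finrank_euclideanSpace_fin]; exact_mod_cast hr
  have hr0 : 0 ≤ r := by linarith
  have hfc : Continuous f := hf.continuous
  have hDc : Continuous fun x => fderiv ℝ f x := hf.continuous_fderiv one_ne_zero
  have hI1 : Integrable f := integrable_of_norm_le_rpow_neg hfc hr2 fun x => by
    rw [Real.norm_eq_abs]; exact h0 x
  have hw1 : ∀ x : EuclideanSpace ℝ (Fin 2), (1 + ‖x‖) ^ (-r) ≤ 1 := fun x => rpow_neg_le_one x hr0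
  have hw0 : ∀ x : EuclideanSpace ℝ (Fin 2), 0 ≤ (1 + ‖x‖) ^ (-r) := fun x =>
    Real.rpow_nonneg (by positivity) _
  have hsq : ∀ {a : ℝ} (x : EuclideanSpace ℝ (Fin 2)), 0 ≤ a → a ≤ A * (1 + ‖x‖) ^ (-r) →
      a ^ 2 ≤ A * A * (1 + ‖x‖) ^ (-r) := by
    intro a x ha hle
    calc a ^ 2 = a * a := sq a
      _ ≤ (A * (1 + ‖x‖) ^ (-r)) * (A * (1 + ‖x‖) ^ (-r)) := mul_le_mul hle hle ha (by positivity)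
      _ ≤ (A * 1) * (A * (1 + ‖x‖) ^ (-r)) := by gcongr; exact hw1 x
      _ = A * A * (1 + ‖x‖) ^ (-r) := by ring
  have hI2 : Integrable fun x => f x ^ 2 :=
    integrable_of_norm_le_rpow_neg (hfc.pow 2) hr2 fun x => by
      rw [Real.norm_of_nonneg (sq_nonneg _), ← sq_abs]
      exact hsq x (abs_nonneg _) (h0 x)
  have hID : Integrable fun x => ‖fderiv ℝ f x‖ ^ 2 :=
    integrable_of_norm_le_rpow_neg (hDc.norm.pow 2) hr2 fun x => by
      rw [Real.norm_of_nonneg (sq_nonneg _)]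
      exact hsq x (norm_nonneg _) (h1 x)
  exact sq_integral_sq_le_nash_of_integrable hf hI1 hI2 hID

end Literature.Analysis.FluidPDE
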